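import Mathlib
import HarnessLib
import Literature.Analysis.FluidPDE.TaoEnstrophyLocalisationProofs
import Summits.NavierStokesRegularity.NavierStokesRegularity.Theorems.PoloidalWindowDoorPoloidalWindowRigidityEnstrophyHotSpot
import Summits.NavierStokesRegularity.NavierStokesRegularity.Theorems.PoloidalWindowDoorPoloidalWindowRigidityLocalStrongMaxPrinciple
import Summits.NavierStokesRegularity.NavierStokesRegularity.Theorems.PoloidalWindowDoorPoloidalWindowRigidityVorticityTranslate

/-!
# Route `PoloidalWindowDoor`, crux `PoloidalWindowRigidity` (K2, stmt-NavierStokesRegularity-19708), residue —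
# M10 sharpened: ONLY NEAR-PEAK POINTS MATTER — critical production where the scale-invariant enstrophy exceeds a
# threshold `θ` forces the scale-invariant enstrophy `≤ θ` everywhere

Cell ns-regularity-ideate, seat nsreg-p7 gen 5 (third worker under the K2 lead; file landed
`--supports stmt-NavierStokesRegularity-19708`).  Sharpening of `…CriticalProduction` (p482981, `θ = 0`):

* `critEnstrophy_le_of_critical_production_above` — for a profile `v` of the route's Type-I class and a threshold
  `θ ≥ 0`: **if the enstrophy production is at most critical, `(−s)⟪ω, Dv ω⟫ ≤ |ω|²`, at every point `(s, y)` where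
  `(−s)²|ω(s,y)|² > θ`, then `(−s)²|ω(s,y)|² ≤ θ` EVERYWHERE.**  Equivalently (residue reading): with
  `S = sup (−t)²|curl v|²`, for every `θ < S` there is a point with `(−s)²|ω|² > θ` AND `(−s)⟪ω, Dv ω⟫ > |ω|²` —
  super-critical stretching occurs at NEAR-RECORD vorticity, not just somewhere.
  Proof: the hot spot `W` (`exists_enstrophy_hotSpot_sup`, with the limit-closed property «critical above `θ`») has
  `(−t)²|curl W|² ≤ M = |curl W(−1,0)|²` with `M > θ`; by joint continuity the weighted enstrophy `Q = t²|ω_W|²` is a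
  sub-solution with dissipation `2t²|∇ω_W|²_F` on a small cylinder around `(−1,0)`, where the LOCAL strong maximum
  principle (`dissipation_eq_zero_of_max_local`, p484155) kills `|∇ω_W|²_F`; real-analyticity of the slice
  (`analyticOnNhd_slice`, identity theorem) spreads `D(curl W(t₁,·)) = 0` from the ball to `ℝ³`, so the slice
  vorticity is constant, and K2-p3's stratum (A) (`eq_zero_of_curl_translate_eq_slice`) gives `W ≡ 0`, contradicting
  `M > 0`.
* poloidal strain form `critEnstrophy_le_of_critical_horizontal_strain_above` and the `θ = 0` recoveries are left to
  the reader of p482981; here only the production form is given, plus the stub-currency corollary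
  `nonflatLiouville_of_critical_production_above` (threshold below the first nonzero value ⇒ not backward-singular is
  NOT claimed — the corollary is the contrapositive packaging: a threshold `θ` that is exceeded somewhere forces a
  super-critical point above `θ`).

WHAT THIS IS NOT: not a proof of K2 and nothing about Clay (A) — a sharper necessary condition on the residue of crux
`PoloidalWindowRigidity` (bears_on LADDER-NS N0, route PoloidalWindowDoor).
-/

noncomputable section

-- the summit and its single sub-problem share the name (CONVENTIONS §1), as in every Theorems file
set_option linter.dupNamespace false

namespace Summit.NavierStokesRegularity.NavierStokesRegularity.Theorems.PoloidalWindowDoorPoloidalWindowRigidityNearPeakCriticalProduction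

open MeasureTheory Set Function Filter Topology TopologicalSpace Metric InnerProductSpace
open scoped RealInnerProductSpace InnerProductSpace Laplacian ContDiff
open Literature.Analysis Literature.Analysis.FluidPDE
open Summit.NavierStokesRegularity.NavierStokesRegularity.Theorems
open Summit.NavierStokesRegularity.NavierStokesRegularity.Theorems.LocalSineTubeDoorProfileAlignedWindowRigidityAncient
open Summit.NavierStokesRegularity.NavierStokesRegularity.Theorems.PoloidalWindowDoorPoloidalWindowRigidityWindow
open Summit.NavierStokesRegularity.NavierStokesRegularity.Theorems.PoloidalWindowDoorPoloidalWindowRigidityFlat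
open Summit.NavierStokesRegularity.NavierStokesRegularity.Theorems.PoloidalWindowDoorPoloidalWindowRigidityPoloidalExtremal
open Summit.NavierStokesRegularity.NavierStokesRegularity.Theorems.PoloidalWindowDoorPoloidalWindowRigidityEnstrophyHotSpot
open Summit.NavierStokesRegularity.NavierStokesRegularity.Theorems.PoloidalWindowDoorPoloidalWindowRigidityLocalStrongMaxPrinciple
open Summit.NavierStokesRegularity.NavierStokesRegularity.Theorems.PoloidalWindowDoorPoloidalWindowRigidityVorticityTranslate

variable {C : ℝ} {v : ℝ → EuclideanSpace ℝ (Fin 3) → EuclideanSpace ℝ (Fin 3)}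

/-! ### «Critical above the threshold `θ`» is preserved by the symmetries and the limits of the class -/

/-- Translation invariance of «production at most critical wherever `(−s)²|ω|² > θ`». -/
theorem critAbove_translate {u : ℝ → EuclideanSpace ℝ (Fin 3) → EuclideanSpace ℝ (Fin 3)} {θ : ℝ}
    (x₀ : EuclideanSpace ℝ (Fin 3))
    (h : ∀ s < 0, ∀ y, θ < (-s) ^ 2 * ⟪curl (u s) y, curl (u s) y⟫_ℝ →
      (-s) * ⟪curl (u s) y, fderiv ℝ (u s) y (curl (u s) y)⟫_ℝ ≤ ⟪curl (u s) y, curl (u s) y⟫_ℝ) :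
    ∀ s < 0, ∀ y, θ < (-s) ^ 2 * ⟪curl (fun x => u s (x₀ + x)) y, curl (fun x => u s (x₀ + x)) y⟫_ℝ →
      (-s) * ⟪curl (fun x => u s (x₀ + x)) y,
        fderiv ℝ (fun x => u s (x₀ + x)) y (curl (fun x => u s (x₀ + x)) y)⟫_ℝ ≤
      ⟪curl (fun x => u s (x₀ + x)) y, curl (fun x => u s (x₀ + x)) y⟫_ℝ := by
  intro s hs y
  rw [curl_translate, fderiv_translate]
  exact h s hs (x₀ + y)

/-- Scaling invariance of «production at most critical wherever `(−s)²|ω|² > θ`» (the threshold is scale-invariant). -/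
theorem critAbove_nsRescale {u : ℝ → EuclideanSpace ℝ (Fin 3) → EuclideanSpace ℝ (Fin 3)} {θ c : ℝ} (hc : 0 < c)
    (h : ∀ s < 0, ∀ y, θ < (-s) ^ 2 * ⟪curl (u s) y, curl (u s) y⟫_ℝ →
      (-s) * ⟪curl (u s) y, fderiv ℝ (u s) y (curl (u s) y)⟫_ℝ ≤ ⟪curl (u s) y, curl (u s) y⟫_ℝ) :
    ∀ s < 0, ∀ y, θ < (-s) ^ 2 * ⟪curl (nsRescale c u s) y, curl (nsRescale c u s) y⟫_ℝ →
      (-s) * ⟪curl (nsRescale c u s) y, fderiv ℝ (nsRescale c u s) y (curl (nsRescale c u s) y)⟫_ℝ ≤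
      ⟪curl (nsRescale c u s) y, curl (nsRescale c u s) y⟫_ℝ := by
  intro s hs y hθ
  have hc2 : 0 < c ^ 2 := pow_pos hc 2
  have hθ' : θ < (-(c ^ 2 * s)) ^ 2 * ⟪curl (u (c ^ 2 * s)) (c • y), curl (u (c ^ 2 * s)) (c • y)⟫_ℝ := by
    have e := critEnstrophy_nsRescale_translate c u 0 s y
    simp only [zero_add] at e
    have e' : (fun t x => u t x) = u := rfl
    rw [e'] at e
    rw [← e]; exact hθ
  have key := h (c ^ 2 * s) (mul_neg_of_pos_of_neg hc2 hs) (c • y) hθ'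
  rw [curl_nsRescale_slice, fderiv_nsRescale_slice]
  simp only [smul_apply, map_smul, real_inner_smul_left, real_inner_smul_right]
  have hc4 : 0 ≤ c ^ 2 * c ^ 2 := by positivity
  nlinarith [mul_le_mul_of_nonneg_left key hc4]

/-- «Production at most critical wherever `(−s)²|ω|² > θ`» passes to pointwise limits of gradients (the threshold
condition is OPEN, so it holds for the approximants eventually). -/
theorem critAbove_of_tendsto {w : ℕ → ℝ → EuclideanSpace ℝ (Fin 3) → EuclideanSpace ℝ (Fin 3)}
    {W : ℝ → EuclideanSpace ℝ (Fin 3) → EuclideanSpace ℝ (Fin 3)} {θ : ℝ}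
    (h : ∀ k, ∀ s < 0, ∀ y, θ < (-s) ^ 2 * ⟪curl (w k s) y, curl (w k s) y⟫_ℝ →
      (-s) * ⟪curl (w k s) y, fderiv ℝ (w k s) y (curl (w k s) y)⟫_ℝ ≤ ⟪curl (w k s) y, curl (w k s) y⟫_ℝ)
    (hgrad : ∀ t < 0, ∀ x, Tendsto (fun j => fderiv ℝ (w j t) x) atTop (𝓝 (fderiv ℝ (W t) x))) :
    ∀ s < 0, ∀ y, θ < (-s) ^ 2 * ⟪curl (W s) y, curl (W s) y⟫_ℝ →
      (-s) * ⟪curl (W s) y, fderiv ℝ (W s) y (curl (W s) y)⟫_ℝ ≤ ⟪curl (W s) y, curl (W s) y⟫_ℝ := by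
  intro s hs y hθ
  have hD := hgrad s hs y
  have hc := tendsto_curl_of_tendsto_fderiv hD
  have happ : Tendsto (fun j => fderiv ℝ (w j s) y (curl (w j s) y)) atTop (𝓝 (fderiv ℝ (W s) y (curl (W s) y))) :=
    ((isBoundedBilinearMap_apply (𝕜 := ℝ) (E := EuclideanSpace ℝ (Fin 3))
      (F := EuclideanSpace ℝ (Fin 3))).continuous.tendsto (fderiv ℝ (W s) y, curl (W s) y)).comp (hD.prodMk_nhds hc)
  have h1 : Tendsto (fun j => (-s) * ⟪curl (w j s) y, fderiv ℝ (w j s) y (curl (w j s) y)⟫_ℝ) atTop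
      (𝓝 ((-s) * ⟪curl (W s) y, fderiv ℝ (W s) y (curl (W s) y)⟫_ℝ)) := (hc.inner happ).const_mul (-s)
  have h2 : Tendsto (fun j => ⟪curl (w j s) y, curl (w j s) y⟫_ℝ) atTop (𝓝 ⟪curl (W s) y, curl (W s) y⟫_ℝ) :=
    hc.inner hc
  have h3 : Tendsto (fun j => (-s) ^ 2 * ⟪curl (w j s) y, curl (w j s) y⟫_ℝ) atTop
      (𝓝 ((-s) ^ 2 * ⟪curl (W s) y, curl (W s) y⟫_ℝ)) := h2.const_mul _
  have hev : ∀ᶠ j in atTop, θ < (-s) ^ 2 * ⟪curl (w j s) y, curl (w j s) y⟫_ℝ := h3.eventually (lt_mem_nhds hθ)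
  exact le_of_tendsto_of_tendsto h1 h2 (hev.mono fun j hj => h j s hs y hj)

/-! ### Only near-peak points matter -/

/-- **ONLY NEAR-PEAK POINTS MATTER (M10 sharpened).**  Let `v` be a profile of the route's Type-I class and `θ ≥ 0`.  If
the enstrophy production is at most critical, `(−s)⟪ω, Dv ω⟫ ≤ |ω|²`, at every point where the scale-invariant
enstrophy `(−s)²|ω|²` exceeds `θ`, then `(−s)²|ω(s,y)|² ≤ θ` at every point.  (`θ = 0`: p482981.) -/
theorem critEnstrophy_le_of_critical_production_above (hrate : HasTypeITimeDecay C v)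
    (hcont : ContinuousOn (uncurry v) (Iio (0 : ℝ) ×ˢ univ))
    (hmild : ∀ s t : ℝ, s < t → t < 0 → ∀ x,
      v t x = UnboundedOperators.heatExtension (v s) (t - s) x - oseenDuhamel 1 s v v t x)
    (hdiv : ∀ t < 0, VectorCalculus.IsDivFree (v t)) {θ : ℝ} (hθ : 0 ≤ θ)
    (hprod : ∀ s < 0, ∀ y, θ < (-s) ^ 2 * ⟪curl (v s) y, curl (v s) y⟫_ℝ →
      (-s) * ⟪curl (v s) y, fderiv ℝ (v s) y (curl (v s) y)⟫_ℝ ≤ ⟪curl (v s) y, curl (v s) y⟫_ℝ) :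
    ∀ s < 0, ∀ y, (-s) ^ 2 * ⟪curl (v s) y, curl (v s) y⟫_ℝ ≤ θ := by
  intro s₀ hs₀ y₀
  by_contra hgt
  push Not at hgt
  have hne : curl (v s₀) y₀ ≠ 0 := by
    intro h0
    rw [h0, inner_zero_left, mul_zero] at hgt
    exact absurd hgt (not_lt.2 hθ)
  have hv : IsTypeIAncientMild C v := isTypeIAncientMild_of_class hrate hcont hmild hdiv
  -- ## the enstrophy hot spot inside the stratum «critical above θ», with `M ≥ (−s₀)²|ω(s₀,y₀)|² > θ`
  obtain ⟨W, M, hW, hPW, hMpos, hvM, hle, hmax⟩ := exists_enstrophy_hotSpot_sup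
    (P := fun u => ∀ s < 0, ∀ y, θ < (-s) ^ 2 * ⟪curl (u s) y, curl (u s) y⟫_ℝ →
      (-s) * ⟪curl (u s) y, fderiv ℝ (u s) y (curl (u s) y)⟫_ℝ ≤ ⟪curl (u s) y, curl (u s) y⟫_ℝ)
    (fun u x₀ hu => critAbove_translate x₀ hu) (fun u c hc hu => critAbove_nsRescale hc hu)
    (fun w W' _ hw _ _ hgrad => critAbove_of_tendsto hw hgrad) hv hprod hs₀ hne
  have hMθ : θ < M := hgt.trans_le (hvM s₀ hs₀ y₀)
  have hWrate : HasTypeITimeDecay C W := hW.hasTypeITimeDecay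
  have hWcont : ContinuousOn (uncurry W) (Iio (0 : ℝ) ×ˢ univ) := hW.continuousOn_uncurry
  have hWmild : ∀ s t : ℝ, s < t → t < 0 → ∀ x,
      W t x = UnboundedOperators.heatExtension (W s) (t - s) x - oseenDuhamel 1 s W W t x :=
    fun s t hst ht x => hW.mild_eq_heatExtension hst ht x
  have hWdiv : ∀ t < 0, VectorCalculus.IsDivFree (W t) := fun t ht => hW.isDivFree ht
  -- ## the critically weighted enstrophy of `W` and its dissipation
  set q : ℝ → EuclideanSpace ℝ (Fin 3) → ℝ := fun τ y => ⟪curl (W τ) y, curl (W τ) y⟫_ℝ with hqdef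
  set Q : ℝ → EuclideanSpace ℝ (Fin 3) → ℝ := fun τ y => τ ^ 2 * q τ y with hQdef
  set Qt : ℝ → EuclideanSpace ℝ (Fin 3) → ℝ := fun τ y => deriv (fun τ' => Q τ' y) τ with hQtdef
  set D : ℝ → EuclideanSpace ℝ (Fin 3) → ℝ := fun τ y =>
    2 * τ ^ 2 * frobeniusNormSq (fderiv ℝ (curl (W τ)) y) with hDdef
  have hg : ∀ τ < (0 : ℝ), HasDerivAt (fun τ : ℝ => τ ^ 2) (2 * τ) τ := fun τ _ => by
    simpa using hasDerivAt_pow 2 τ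
  have hid := fun τ (hτ : τ < 0) y => weightedEnstrophy_identity hWrate hWcont hWmild hWdiv hg hτ y
  -- ## regularity on the slab `[−2, −1/2] × ℝ³`
  have hslab : ∀ t ∈ Icc (-2 : ℝ) (-1 / 2), t < 0 := fun t ht => by linarith [ht.2]
  obtain ⟨B, hB⟩ := bdd_of_hasTypeITimeDecay hWrate (1 / 4) (by norm_num)
  have hsmω : IsSmoothSpaceTimeOn (Iio 0) (vorticity W) :=
    (show IsSmoothSpaceTimeOn (Iio 0) W from hW.contDiffOn).isSmoothSpaceTimeOn_vorticity isOpen_Iio.uniqueDiffOn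
  have hq_c : ContinuousOn (uncurry q) (Icc (-2 : ℝ) (-1 / 2) ×ˢ univ) := by
    have hωc : ContinuousOn (uncurry (vorticity W)) (Icc (-2 : ℝ) (-1 / 2) ×ˢ univ) :=
      hsmω.continuousOn.mono (prod_mono (fun t ht => hslab t ht) Subset.rfl)
    have h : ContinuousOn (fun z => ⟪uncurry (vorticity W) z, uncurry (vorticity W) z⟫_ℝ)
        (Icc (-2 : ℝ) (-1 / 2) ×ˢ univ) := hωc.inner hωc
    refine h.congr fun z _ => ?_
    simp only [hqdef, uncurry, vorticity_apply]
  have hQ_c : ContinuousOn (uncurry Q) (Icc (-2 : ℝ) (-1 / 2) ×ˢ univ) := by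
    have hg1 : ContinuousOn (fun z : ℝ × EuclideanSpace ℝ (Fin 3) => z.1 ^ 2) (Icc (-2 : ℝ) (-1 / 2) ×ˢ univ) :=
      (continuous_fst.pow 2).continuousOn
    refine (hg1.mul hq_c).congr fun z _ => ?_
    rcases z with ⟨a, b⟩
    rfl
  have hq2 : ∀ t < (0 : ℝ), ContDiff ℝ 2 (q t) := fun t ht => by
    have hΩ : ContDiff ℝ 2 (curl (W t)) :=
      contDiff_curl (n := 2) (analyticOnNhd_slice hWcont (bdd_of_hasTypeITimeDecay hWrate) hWmild ht).contDiff
    exact hΩ.inner ℝ hΩ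
  -- ## a small cylinder around `(−1, 0)` on which `Q > θ`
  obtain ⟨ε, hε, hε1, hQθ⟩ : ∃ ε > 0, ε ≤ 1 / 2 ∧ ∀ (t : ℝ) (x : EuclideanSpace ℝ (Fin 3)),
      |t + 1| < ε → ‖x‖ < ε → θ < Q t x := by
    have hmem : Icc (-2 : ℝ) (-1 / 2) ×ˢ (univ : Set (EuclideanSpace ℝ (Fin 3))) ∈ 𝓝 ((-1 : ℝ), (0 : _)) :=
      prod_mem_nhds (Icc_mem_nhds (by norm_num) (by norm_num)) univ_mem
    have hca : ContinuousAt (uncurry Q) ((-1 : ℝ), (0 : EuclideanSpace ℝ (Fin 3))) :=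
      (hQ_c _ (mem_of_mem_nhds hmem)).continuousAt hmem
    have hQ1 : θ < uncurry Q ((-1 : ℝ), (0 : EuclideanSpace ℝ (Fin 3))) := by
      simp only [uncurry, hQdef, hqdef, hmax]; norm_num; exact hMθ
    have hev := hca.eventually (lt_mem_nhds hQ1)
    rw [Metric.eventually_nhds_iff] at hev
    obtain ⟨ε₀, hε₀, h⟩ := hev
    refine ⟨min ε₀ (1 / 2), lt_min hε₀ (by norm_num), min_le_right _ _, fun t x ht hx => ?_⟩
    have hd : dist (t, x) ((-1 : ℝ), (0 : EuclideanSpace ℝ (Fin 3))) < ε₀ := by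
      rw [Prod.dist_eq]
      refine max_lt ?_ ?_
      · rw [Real.dist_eq]; simpa using ht.trans_le (min_le_left _ _)
      · rw [dist_zero_right]; exact hx.trans_le (min_le_left _ _)
    exact h hd
  -- the cylinder `[−1 − ε/2, −1] × B̄(0, ε/2)` and the hypotheses of the local dissipation lemma on it
  set t₀ : ℝ := -1 - ε / 2 with ht₀
  have hIcc : Icc t₀ (-1) ⊆ Icc (-2 : ℝ) (-1 / 2) := Icc_subset_Icc (by rw [ht₀]; linarith) (by norm_num)
  have hin : ∀ t ∈ Icc t₀ (-1), ∀ x : EuclideanSpace ℝ (Fin 3), ‖x - 0‖ ≤ ε / 2 → θ < Q t x := by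
    intro t ht x hx
    refine hQθ t x ?_ ?_
    · rw [abs_lt]; constructor <;> [linarith [ht.1]; linarith [ht.2]]
    · rw [sub_zero] at hx; linarith
  have hbA : ∀ t ∈ Icc t₀ (-1), ∀ x : EuclideanSpace ℝ (Fin 3), ‖x - 0‖ ≤ ε / 2 → ‖W t x‖ ≤ B :=
    fun t ht x _ => hB t (by linarith [ht.2]) x
  have hQ_c' : ContinuousOn (uncurry Q) (Icc t₀ (-1) ×ˢ univ) := hQ_c.mono (prod_mono hIcc Subset.rfl)
  have hQ2 : ∀ t ∈ Icc t₀ (-1), ContDiff ℝ 2 (Q t) := fun t ht => by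
    have h : ContDiff ℝ 2 (fun y => t ^ 2 * q t y) := contDiff_const.mul (hq2 t (hslab t (hIcc ht)))
    exact h
  have hQt : ∀ x, ∀ t ∈ Icc t₀ (-1), HasDerivAt (fun τ => Q τ x) (Qt t x) t :=
    fun x t ht => (hid t (hslab t (hIcc ht)) x).1
  have hD0 : ∀ t ∈ Ioc t₀ (-1), ∀ x : EuclideanSpace ℝ (Fin 3), ‖x - 0‖ < ε / 2 → 0 ≤ D t x := fun t _ x _ => by
    simp only [hDdef]
    exact mul_nonneg (by positivity) (frobeniusNormSq_nonneg _)
  have hlawD : ∀ t ∈ Ioc t₀ (-1), ∀ x : EuclideanSpace ℝ (Fin 3), ‖x - 0‖ < ε / 2 →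
      Qt t x + fderiv ℝ (Q t) x (W t x) - (Δ (Q t)) x ≤ -D t x := by
    intro t ht x hx
    have htn : t < 0 := hslab t (hIcc ⟨ht.1.le, ht.2⟩)
    have h := (hid t htn x).2
    have hθQ : θ < (-t) ^ 2 * ⟪curl (W t) x, curl (W t) x⟫_ℝ := by
      have := hin t ⟨ht.1.le, ht.2⟩ x hx.le
      simp only [hQdef, hqdef] at this
      rwa [neg_sq]
    have hP := hPW t htn x hθQ
    have h1 : t ^ 2 * ⟪curl (W t) x, fderiv ℝ (W t) x (curl (W t) x)⟫_ℝ ≤ (-t) * q t x := by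
      have h2 := mul_le_mul_of_nonneg_left hP (neg_pos.2 htn).le
      simp only [hqdef]
      nlinarith [h2]
    simp only [hQtdef, hQdef, hDdef, hqdef] at h h1 ⊢
    rw [h]
    nlinarith [h1]
  have hle' : ∀ t ∈ Icc t₀ (-1), ∀ x : EuclideanSpace ℝ (Fin 3), ‖x - 0‖ ≤ ε / 2 → Q t x ≤ M := fun t ht x _ => by
    have h := hle t (hslab t (hIcc ht)) x
    rw [neg_sq] at h
    exact h
  have hmaxQ : Q (-1) 0 = M := by
    simp only [hQdef, hqdef, hmax]
    norm_num
  have hts : (-1 : ℝ) ∈ Ioc t₀ (-1) := ⟨by rw [ht₀]; linarith, le_rfl⟩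
  have hxs : ‖(0 : EuclideanSpace ℝ (Fin 3)) - 0‖ < ε / 2 := by simp [hε]
  have hdis := dissipation_eq_zero_of_max_local (x₀ := (0 : EuclideanSpace ℝ (Fin 3))) hbA hQ_c' hQ2 hQt hD0
    hlawD hle' hts hxs hmaxQ
  -- ## on the slice `t₁ = −1 − ε/4` the vorticity gradient vanishes on the ball, hence everywhere (analyticity)
  set t₁ : ℝ := -1 - ε / 4 with ht₁
  have ht₁I : t₁ ∈ Ioo t₀ (-1) := by rw [ht₀, ht₁]; constructor <;> linarith
  have ht₁n : t₁ < 0 := by rw [ht₁]; linarith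
  have hFball : ∀ x : EuclideanSpace ℝ (Fin 3), ‖x - 0‖ < ε / 2 → fderiv ℝ (curl (W t₁)) x = 0 := by
    intro x hx
    have h := hdis t₁ ht₁I x hx
    have hfrob : frobeniusNormSq (fderiv ℝ (curl (W t₁)) x) = 0 := by
      have h2 : (2 : ℝ) * t₁ ^ 2 ≠ 0 := mul_ne_zero two_ne_zero (pow_ne_zero 2 ht₁n.ne)
      simp only [hDdef] at h
      exact (mul_eq_zero.1 h).resolve_left h2
    have hn : ‖fderiv ℝ (curl (W t₁)) x‖ ^ 2 ≤ 0 := by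
      have h3 := sq_opNorm_le_frobeniusNormSq (fderiv ℝ (curl (W t₁)) x)
      rw [hfrob] at h3
      exact h3
    have hn0 : ‖fderiv ℝ (curl (W t₁)) x‖ = 0 := by
      nlinarith [norm_nonneg (fderiv ℝ (curl (W t₁)) x)]
    exact norm_eq_zero.1 hn0
  have hanW : AnalyticOnNhd ℝ (W t₁) univ :=
    analyticOnNhd_slice hWcont (bdd_of_hasTypeITimeDecay hWrate) hWmild ht₁n
  have hanF : AnalyticOnNhd ℝ (fderiv ℝ (curl (W t₁))) univ := by
    have h1 : AnalyticOnNhd ℝ (curl (W t₁)) univ := by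
      rw [curl_eq_curlCLM_comp]
      exact curlCLM.comp_analyticOnNhd hanW.fderiv
    exact h1.fderiv
  have hF : ∀ x, fderiv ℝ (curl (W t₁)) x = 0 := by
    have hev : fderiv ℝ (curl (W t₁)) =ᶠ[𝓝 (0 : EuclideanSpace ℝ (Fin 3))] 0 := by
      have hball : {y : EuclideanSpace ℝ (Fin 3) | ‖y - 0‖ < ε / 2} ∈ 𝓝 (0 : EuclideanSpace ℝ (Fin 3)) :=
        (isOpen_lt (continuous_id.sub continuous_const).norm continuous_const).mem_nhds (by simp [hε])
      filter_upwards [hball] with y hy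
      exact hFball y hy
    have h := hanF.eqOn_zero_of_preconnected_of_eventuallyEq_zero isPreconnected_univ (mem_univ 0) hev
    exact fun x => h (mem_univ x)
  -- ## the slice vorticity is constant, so `W ≡ 0`: contradiction with `M > 0`
  have hΩd : Differentiable ℝ (curl (W t₁)) := (contDiff_curl (n := 1) hanW.contDiff).differentiable one_ne_zero
  have hconst : ∀ (y : EuclideanSpace ℝ (Fin 3)) (l : ℝ),
      curl (W t₁) (y + l • EuclideanSpace.single 0 (1 : ℝ)) = curl (W t₁) y :=
    fun y l => is_const_of_fderiv_eq_zero hΩd hF _ _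
  have he : (EuclideanSpace.single (0 : Fin 3) (1 : ℝ) : EuclideanSpace ℝ (Fin 3)) ≠ 0 := fun h => by
    simpa using congrArg (fun w : EuclideanSpace ℝ (Fin 3) => w 0) h
  have hW0 : ∀ t < 0, ∀ x, W t x = 0 :=
    eq_zero_of_curl_translate_eq_slice hWrate hWcont hWmild hWdiv ht₁n he hconst
  have hc0 : curl (W (-1)) 0 = 0 := by
    have hslice : W (-1) = fun _ => 0 := funext fun x => hW0 (-1) (by norm_num) x
    rw [curl_eq_curlCLM, hslice]
    simp
  rw [hc0, inner_zero_left] at hmax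
  exact absurd hmax hMpos.ne

/-- **Residue reading (stub currency).**  For a profile of the class with SOME point of positive scale-invariant
enstrophy above `θ ≥ 0`, at-most-critical production at all points above `θ` is impossible: there is a point with
`(−s)²|ω|² > θ` and `(−s)⟪ω, Dv ω⟫ > |ω|²`. -/
theorem exists_supercritical_above (hrate : HasTypeITimeDecay C v)
    (hcont : ContinuousOn (uncurry v) (Iio (0 : ℝ) ×ˢ univ))
    (hmild : ∀ s t : ℝ, s < t → t < 0 → ∀ x,
      v t x = UnboundedOperators.heatExtension (v s) (t - s) x - oseenDuhamel 1 s v v t x)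
    (hdiv : ∀ t < 0, VectorCalculus.IsDivFree (v t)) {θ : ℝ} (hθ : 0 ≤ θ)
    {s₀ : ℝ} (hs₀ : s₀ < 0) {y₀ : EuclideanSpace ℝ (Fin 3)}
    (habove : θ < (-s₀) ^ 2 * ⟪curl (v s₀) y₀, curl (v s₀) y₀⟫_ℝ) :
    ∃ s < 0, ∃ y, θ < (-s) ^ 2 * ⟪curl (v s) y, curl (v s) y⟫_ℝ ∧
      ⟪curl (v s) y, curl (v s) y⟫_ℝ < (-s) * ⟪curl (v s) y, fderiv ℝ (v s) y (curl (v s) y)⟫_ℝ := by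
  by_contra h
  push Not at h
  have hle := critEnstrophy_le_of_critical_production_above hrate hcont hmild hdiv hθ
    (fun s hs y hθ' => h s hs y hθ') s₀ hs₀ y₀
  exact absurd habove (not_lt.2 hle)

/-! ### Poloidal strain form (appended) -/

open Summit.NavierStokesRegularity.NavierStokesRegularity.Theorems.PoloidalWindowDoorPoloidalWindowRigidityStrainRate in
/-- **Poloidal strain form of «only near-peak points matter».**  For a profile of the class, poloidal along `e₃` on
every slice, and `θ ≥ 0`: if at every point where `(−s)²|ω|² > θ` the horizontal strain is at most critical,
`(−s)⟪Dv(s,y) a, a⟫ ≤ ‖a‖²` for all horizontal `a`, then `(−s)²|ω|² ≤ θ` everywhere (p473649's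
`production_le_of_horizontal_strain` with `Λ = 1`, pointwise, + `critEnstrophy_le_of_critical_production_above`). -/
theorem critEnstrophy_le_of_critical_horizontal_strain_above (hrate : HasTypeITimeDecay C v)
    (hcont : ContinuousOn (uncurry v) (Iio (0 : ℝ) ×ˢ univ))
    (hmild : ∀ s t : ℝ, s < t → t < 0 → ∀ x,
      v t x = UnboundedOperators.heatExtension (v s) (t - s) x - oseenDuhamel 1 s v v t x)
    (hdiv : ∀ t < 0, VectorCalculus.IsDivFree (v t)) {θ : ℝ} (hθ : 0 ≤ θ)
    (hpol : ∀ s < 0, ∀ y, ⟪curl (v s) y, EuclideanSpace.single 2 (1 : ℝ)⟫_ℝ = 0)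
    (hstrain : ∀ s < 0, ∀ (y a : EuclideanSpace ℝ (Fin 3)), θ < (-s) ^ 2 * ⟪curl (v s) y, curl (v s) y⟫_ℝ →
      ⟪a, EuclideanSpace.single 2 (1 : ℝ)⟫_ℝ = 0 → (-s) * ⟪fderiv ℝ (v s) y a, a⟫_ℝ ≤ ‖a‖ ^ 2) :
    ∀ s < 0, ∀ y, (-s) ^ 2 * ⟪curl (v s) y, curl (v s) y⟫_ℝ ≤ θ := by
  refine critEnstrophy_le_of_critical_production_above hrate hcont hmild hdiv hθ fun s hs y hθ' => ?_
  have h := production_le_of_horizontal_strain (Λ := 1) (hpol s hs y) (fun a ha => by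
    rw [one_mul]; exact hstrain s hs y a hθ' ha)
  rwa [one_mul] at h

/-- **Residue reading, poloidal strain form.**  If the scale-invariant enstrophy of a poloidal profile of the class
exceeds `θ ≥ 0` somewhere, then at some point where it exceeds `θ` some horizontal direction is stretched STRICTLY
faster than the critical rate: `‖a‖² < (−s)⟪Dv(s,y) a, a⟫`, `a ⊥ e₃`. -/
theorem exists_supercritical_horizontal_above (hrate : HasTypeITimeDecay C v)
    (hcont : ContinuousOn (uncurry v) (Iio (0 : ℝ) ×ˢ univ))
    (hmild : ∀ s t : ℝ, s < t → t < 0 → ∀ x,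
      v t x = UnboundedOperators.heatExtension (v s) (t - s) x - oseenDuhamel 1 s v v t x)
    (hdiv : ∀ t < 0, VectorCalculus.IsDivFree (v t)) {θ : ℝ} (hθ : 0 ≤ θ)
    (hpol : ∀ s < 0, ∀ y, ⟪curl (v s) y, EuclideanSpace.single 2 (1 : ℝ)⟫_ℝ = 0)
    {s₀ : ℝ} (hs₀ : s₀ < 0) {y₀ : EuclideanSpace ℝ (Fin 3)}
    (habove : θ < (-s₀) ^ 2 * ⟪curl (v s₀) y₀, curl (v s₀) y₀⟫_ℝ) :
    ∃ s < 0, ∃ (y a : EuclideanSpace ℝ (Fin 3)), θ < (-s) ^ 2 * ⟪curl (v s) y, curl (v s) y⟫_ℝ ∧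
      ⟪a, EuclideanSpace.single 2 (1 : ℝ)⟫_ℝ = 0 ∧ ‖a‖ ^ 2 < (-s) * ⟪fderiv ℝ (v s) y a, a⟫_ℝ := by
  by_contra h
  push Not at h
  have hle := critEnstrophy_le_of_critical_horizontal_strain_above hrate hcont hmild hdiv hθ hpol
    (fun s hs y a hθ' ha => h s hs y a hθ' ha) s₀ hs₀ y₀
  exact absurd habove (not_lt.2 hle)

end Summit.NavierStokesRegularity.NavierStokesRegularity.Theorems.PoloidalWindowDoorPoloidalWindowRigidityNearPeakCriticalProduction

end
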